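import Summits.KontsevichZagierPeriods.KontsevichZagierPeriods.Theorems.AbelContractionRealHyperellipticSectorTransportArcsKit

/-!
# Route AbelContraction — `RealHyperellipticSector` (crux stmt-KontsevichZagierPeriods-12475): the Möbius transport of arcs

Pure proof file of the line `Lines/birth.lean` (registered brick `transport_arcs` of the stub
`stub_complete`, `--supports` the crux). **Möbius transport between models inside dimension
one**: if `q′(u) = u^{2m} q(c + 1/u)` (`q q′ ∈ ℚ[X]`, `c ∈ ℚ`), every element of the subgroup of
`KZ.FormalRep` generated by the arc generators `[S, (A + B√q)/D]` of the sector of `q`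
(`S ⊆ {q > 0, D ≠ 0}` an open interval, `A B D ∈ ℚ[X]`) and the constants is congruent modulo the
truncated relations `KZ.relationsLE 1` to an element of the subgroup generated by the arc
generators of the sector of `q′` and the constants.

Proof. One arc at a time (`Transport.exists_of_mem_arcs`), then
`closure (arcs q ∪ consts) ≤ closure (arcs q′ ∪ consts) ⊔ relationsLE 1` generator by generator.
An arc over `S ∋ c` is first cut at `c` (rule (1a) twice, `Budget.split_mem_relationsLE`, the
point `{c}` being a truncated relation, `Budget.of_mem_relationsLE_of_subset_point`); on an arc
over an interval `S ∌ c` (`Transport.moebius_oneSided`) the substitution `u = 1/(x − c)`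
(inverse `x = c + 1/u`, `|dx| = du/u²`, `|u| = εu` on the image with `ε = ±1` the side of `c`)
is ONE move of rule (2) to an arc of `q′` (`Transport.exists_arc_of_subst` of the kit): with
`√q(c + 1/u) = √q′(u)/|u|^m` the pushed-forward integrand is
`α(u) + β(u)√q′(u)`, `α = A(c + 1/u)/(D(c + 1/u)u²)`, `β = B(c + 1/u)/((εu)^m D(c + 1/u)u²)`
`ℚ`-rational on the image, i.e. of the arc shape `(A″ + B″√q′)/D″` (`Transport.arcShape_of_qrat`),
and `q′ = u^{2m} q > 0` there.

References: M. Kontsevich, D. Zagier, *Periods* (2001), §1.2 rules (1)–(2) [KontsevichZagier2001].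
No definitions are introduced.
-/

noncomputable section

open Set MeasureTheory
open scoped Polynomial
open Literature.ModelTheory.ExponentialFields (IsSemialgebraic isSemialgebraic_univ)
open Literature.NumberTheory.Transcendental Literature.NumberTheory.Transcendental.KZ

namespace Summit.KontsevichZagierPeriods.AbelContraction.RealHyperellipticSector

namespace Transport

/-! ## The Möbius move on a one-sided arc -/

/-- **The Möbius substitution on a one-sided arc (one move of rule (2) inside dimension one).**
If `q′(u) = u^{2m} q(c + 1/u)` for `u ≠ 0` and `[S, (A + B√q)/D]` is an arc of the sector of `q`
over an open interval `S ∌ c`, then `u = 1/(x − c)` carries it, modulo `KZ.relationsLE 1`, to an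
arc of the sector of `q′`: on the image `|u| = εu` (`ε = ±1`), `√q(c + 1/u) = √q′(u)/(εu)^m`,
`|dx| = du/u²`, so the new integrand is `α + β√q′` with `α, β` `ℚ`-rational.
[cite: KontsevichZagier2001, §1.2 rule (2)] -/
theorem moebius_oneSided {q q' : ℚ[X]} {c : ℚ} {m : ℕ}
    (hqq : ∀ u : ℝ, u ≠ 0 → (Polynomial.aeval u q' : ℝ) =
      u ^ (2 * m) * Polynomial.aeval ((c : ℝ) + u⁻¹) q)
    (r : IntegralRep 1) (A B D : ℚ[X]) {S : Set ℝ} (hS : IsOpen S) (hSo : S.OrdConnected)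
    (hdom : r.domain = {p | p 0 ∈ S}) (hpos : ∀ x ∈ S, 0 < (Polynomial.aeval x q : ℝ))
    (hD : ∀ x ∈ S, (Polynomial.aeval x D : ℝ) ≠ 0)
    (hint : ∀ p ∈ r.domain, r.integrand p = (Polynomial.aeval (p 0) A +
      Polynomial.aeval (p 0) B * √(Polynomial.aeval (p 0) q : ℝ)) / Polynomial.aeval (p 0) D)
    (hc : (c : ℝ) ∉ S) : ∃ x' ∈ arcs q', of r - x' ∈ relationsLE 1 := by
  have hmem : ∀ p, p ∈ r.domain ↔ p 0 ∈ S := fun p => by rw [hdom]; rfl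
  have hσ := r.isSemialgebraic_domain
  -- the side of `c`, as a rational sign `ε = ±1`
  obtain ⟨sgn, hsgn, habs⟩ := Euler.exists_sign_of_notMem hSo hc
  obtain ⟨ε, rfl⟩ : ∃ ε : ℚ, (ε : ℝ) = sgn := by
    rcases hsgn with h | h
    · exact ⟨1, by rw [h, Rat.cast_one]⟩
    · exact ⟨-1, by rw [h, Rat.cast_neg, Rat.cast_one]⟩
  have hεinv : ((ε : ℝ))⁻¹ = ε := by
    rcases hsgn with h | h <;> rw [h] <;> norm_num
  have hxc : ∀ x ∈ S, x - (c : ℝ) ≠ 0 := fun x hx h => by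
    rw [sub_eq_zero] at h
    rw [h] at hx
    exact hc hx
  -- facts on `S`, read through `u = (x - c)⁻¹`
  have hu0 : ∀ x ∈ S, (x - (c : ℝ))⁻¹ ≠ 0 := fun x hx => inv_ne_zero (hxc x hx)
  have hψφ : ∀ x ∈ S, (c : ℝ) + ((x - (c : ℝ))⁻¹)⁻¹ = x := fun x _ => by
    rw [inv_inv]
    ring
  have habsu : ∀ x ∈ S, |(x - (c : ℝ))⁻¹| = ε * (x - (c : ℝ))⁻¹ := fun x hx => by
    rw [abs_inv, habs x hx, mul_inv, hεinv]
  have hsqrt : ∀ x ∈ S, √(Polynomial.aeval (x - (c : ℝ))⁻¹ q' : ℝ) =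
      |(x - (c : ℝ))⁻¹| ^ m * √(Polynomial.aeval x q : ℝ) := fun x hx => by
    rw [hqq _ (hu0 x hx), hψφ x hx, pow_mul', Real.sqrt_mul (sq_nonneg _), Real.sqrt_sq_eq_abs,
      abs_pow]
  -- the same facts on the image `T`
  set T : Set ℝ := (fun x : ℝ => (x - (c : ℝ))⁻¹) '' S with hT_def
  have hT0 : ∀ u ∈ T, u ≠ 0 := by
    rintro _ ⟨x, hx, rfl⟩
    exact hu0 x hx
  have hTS : ∀ u ∈ T, (c : ℝ) + u⁻¹ ∈ S := by
    rintro _ ⟨x, hx, rfl⟩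
    beta_reduce
    rw [hψφ x hx]
    exact hx
  have hTabs : ∀ u ∈ T, |u| = ε * u := by
    rintro _ ⟨x, hx, rfl⟩
    exact habsu x hx
  have hTε : ∀ u ∈ T, ((ε : ℝ) * u) ^ m ≠ 0 := fun u hu => by
    rw [← hTabs u hu]
    exact pow_ne_zero _ (abs_ne_zero.mpr (hT0 u hu))
  have hTpos : ∀ u ∈ T, 0 < (Polynomial.aeval u q' : ℝ) := by
    rintro _ ⟨x, hx, rfl⟩
    beta_reduce
    rw [hqq _ (hu0 x hx), hψφ x hx]
    exact mul_pos ((even_two_mul m).pow_pos (hu0 x hx)) (hpos x hx)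
  have hTD : ∀ u ∈ T, (Polynomial.aeval ((c : ℝ) + u⁻¹) D : ℝ) * u ^ 2 ≠ 0 := fun u hu =>
    mul_ne_zero (hD _ (hTS u hu)) (pow_ne_zero 2 (hT0 u hu))
  -- the coefficients `α`, `β` of the pushed-forward integrand are `ℚ`-rational on `T`
  have hψT : ∃ P Q : ℚ[X], ∀ t ∈ T, (Polynomial.aeval t Q : ℝ) ≠ 0 ∧
      (fun u : ℝ => (c : ℝ) + u⁻¹) t = (Polynomial.aeval t P : ℝ) / (Polynomial.aeval t Q : ℝ) :=
    qrat_add (qrat_const T c) (qrat_inv (qrat_id T) hT0)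
  have hα : ∃ P Q : ℚ[X], ∀ t ∈ T, (Polynomial.aeval t Q : ℝ) ≠ 0 ∧
      (fun u : ℝ => (Polynomial.aeval ((c : ℝ) + u⁻¹) A : ℝ) /
        ((Polynomial.aeval ((c : ℝ) + u⁻¹) D : ℝ) * u ^ 2)) t =
        (Polynomial.aeval t P : ℝ) / (Polynomial.aeval t Q : ℝ) :=
    qrat_div (qrat_aeval A hψT) (qrat_mul (qrat_aeval D hψT) (qrat_pow (qrat_id T) 2)) hTD
  have hβ : ∃ P Q : ℚ[X], ∀ t ∈ T, (Polynomial.aeval t Q : ℝ) ≠ 0 ∧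
      (fun u : ℝ => (Polynomial.aeval ((c : ℝ) + u⁻¹) B : ℝ) * (((ε : ℝ) * u) ^ m)⁻¹ /
        ((Polynomial.aeval ((c : ℝ) + u⁻¹) D : ℝ) * u ^ 2)) t =
        (Polynomial.aeval t P : ℝ) / (Polynomial.aeval t Q : ℝ) :=
    qrat_div (qrat_mul (qrat_aeval B hψT)
      (qrat_inv (qrat_pow (qrat_mul (qrat_const T ε) (qrat_id T)) m) hTε))
      (qrat_mul (qrat_aeval D hψT) (qrat_pow (qrat_id T) 2)) hTD
  obtain ⟨A'', B'', D'', hABD⟩ :=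
    arcShape_of_qrat (fun u => √(Polynomial.aeval u q' : ℝ)) hα hβ
  -- semialgebraicity of `φ = 1/(x - c)`, `φ' = -1/(x - c)²`, `ψ = c + 1/u`
  have hx0 : IsSemialgebraicFunOn ℚ r.domain (fun p : Fin 1 → ℝ => p 0) := by
    simpa using isSemialgebraicFunOn_aeval hσ (MvPolynomial.X 0 : MvPolynomial (Fin 1) ℚ)
  have hxcs : IsSemialgebraicFunOn ℚ r.domain (fun p => p 0 - (c : ℝ)) :=
    hx0.fun_sub (isSemialgebraicFunOn_const_ratCast hσ c)
  have hφ : IsSemialgebraicFunOn ℚ r.domain (fun p => (p 0 - (c : ℝ))⁻¹) := hxcs.fun_inv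
  have hφ' : IsSemialgebraicFunOn ℚ r.domain (fun p => -1 / (p 0 - (c : ℝ)) ^ 2) :=
    ((hxcs.fun_pow 2).fun_inv.fun_neg).congr fun p _ => by rw [neg_div, one_div]
  have hx0u : IsSemialgebraicFunOn ℚ (univ : Set (Fin 1 → ℝ)) (fun p : Fin 1 → ℝ => p 0) := by
    simpa using isSemialgebraicFunOn_aeval (isSemialgebraic_univ (k := ℚ))
      (MvPolynomial.X 0 : MvPolynomial (Fin 1) ℚ)
  have hψ : IsSemialgebraicFunOn ℚ (univ : Set (Fin 1 → ℝ)) (fun p => (c : ℝ) + (p 0)⁻¹) :=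
    (isSemialgebraicFunOn_const_ratCast isSemialgebraic_univ c).fun_add hx0u.fun_inv
  -- the derivative
  have hder : ∀ x ∈ S, HasDerivAt (fun y : ℝ => (y - (c : ℝ))⁻¹) (-1 / (x - (c : ℝ)) ^ 2) x :=
    fun x hx => ((hasDerivAt_id' x).sub_const (c : ℝ)).fun_inv (hxc x hx)
  have hne : ∀ x ∈ S, -1 / (x - (c : ℝ)) ^ 2 ≠ 0 := fun x hx =>
    div_ne_zero (by norm_num) (pow_ne_zero 2 (hxc x hx))
  refine exists_arc_of_subst q' r S hS hSo hdom (fun x => (x - (c : ℝ))⁻¹)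
    (fun x => -1 / (x - (c : ℝ)) ^ 2) (fun u => (c : ℝ) + u⁻¹)
    (fun u => (Polynomial.aeval ((c : ℝ) + u⁻¹) A : ℝ) /
        ((Polynomial.aeval ((c : ℝ) + u⁻¹) D : ℝ) * u ^ 2) +
      (Polynomial.aeval ((c : ℝ) + u⁻¹) B : ℝ) * (((ε : ℝ) * u) ^ m)⁻¹ /
        ((Polynomial.aeval ((c : ℝ) + u⁻¹) D : ℝ) * u ^ 2) * √(Polynomial.aeval u q' : ℝ))
    hφ hφ' hder hne hψ hψφ hTpos ⟨A'', B'', D'', hABD⟩ fun p hp => ?_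
  -- the Jacobian identity on the slab
  have hx := (hmem p).1 hp
  have h1 := hxc _ hx
  have h2 := hD _ hx
  have h3 : ((ε : ℝ) * (p 0 - (c : ℝ))⁻¹) ^ m ≠ 0 := hTε _ ⟨p 0, hx, rfl⟩
  have h4 : |(-1 : ℝ) / (p 0 - (c : ℝ)) ^ 2| = (p 0 - (c : ℝ))⁻¹ ^ 2 := by
    rw [abs_div, abs_neg, abs_one, abs_pow, sq_abs, one_div, inv_pow]
  rw [hint p hp, hsqrt _ hx, habsu _ hx, hψφ _ hx, h4]
  generalize ((ε : ℝ) * (p 0 - (c : ℝ))⁻¹) ^ m = E at h3 ⊢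
  field_simp

/-! ## One arc: cut at `c`, then move the two sides -/

/-- **Transport of one arc.** If `q′(u) = u^{2m} q(c + 1/u)` for `u ≠ 0`, every arc generator of
the sector of `q` is congruent modulo `KZ.relationsLE 1` to a sum of (at most two) arc
generators of the sector of `q′`: cut the arc at `c` (rule (1a) twice, the point `{c}` being a
truncated relation) and move each side by the Möbius substitution `u = 1/(x − c)`.
[cite: KontsevichZagier2001, §1.2 rules (1)–(2)] -/
theorem exists_of_mem_arcs {q q' : ℚ[X]} {c : ℚ} {m : ℕ}
    (hqq : ∀ u : ℝ, u ≠ 0 → (Polynomial.aeval u q' : ℝ) =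
      u ^ (2 * m) * Polynomial.aeval ((c : ℝ) + u⁻¹) q)
    {y : FormalRep} (hy : y ∈ arcs q) :
    ∃ x' ∈ AddSubgroup.closure (arcs q' ∪ consts), y - x' ∈ relationsLE 1 := by
  obtain ⟨r, A, B, D, S, hS, hSo, hdom, hposD, hint, rfl⟩ := hy
  have hmem : ∀ p, p ∈ r.domain ↔ p 0 ∈ S := fun p => by rw [hdom]; rfl
  -- a piece of `r` over a one-sided subinterval is moved by `moebius_oneSided`
  have piece : ∀ (N : IntegralRep 1) (S' : Set ℝ), IsOpen S' → S'.OrdConnected → S' ⊆ S →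
      (c : ℝ) ∉ S' → N.domain = {p | p 0 ∈ S'} → N.integrand = r.integrand →
      ∃ x' ∈ arcs q', of N - x' ∈ relationsLE 1 := by
    intro N S' hS' hSo' hS'S hc hNd hNi
    have hmem' : ∀ p, p ∈ N.domain ↔ p 0 ∈ S' := fun p => by rw [hNd]; rfl
    refine moebius_oneSided hqq N A B D hS' hSo' hNd
      (fun x hx => (hposD (fun _ => x) ((hmem _).2 (hS'S hx))).1)
      (fun x hx => (hposD (fun _ => x) ((hmem _).2 (hS'S hx))).2) (fun p hp => ?_) hc
    rw [hNi]
    exact hint ((hmem p).2 (hS'S ((hmem' p).1 hp)))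
  -- the two cuts
  have hcA : IsAlgebraic ℚ ((c : ℚ) : ℝ) := isAlgebraic_algebraMap c
  have hA₁ : IsSemialgebraic ℚ {p : Fin 1 → ℝ | p 0 < (c : ℝ)} :=
    isSemialgebraic_setOf_apply_lt_const hcA 0
  have hA₂ : IsSemialgebraic ℚ {p : Fin 1 → ℝ | (c : ℝ) < p 0} :=
    isSemialgebraic_setOf_const_lt_apply hcA 0
  set r₁ := r.restrict (r.domain ∩ {p : Fin 1 → ℝ | p 0 < (c : ℝ)})
    (r.isSemialgebraic_domain.inter hA₁) inter_subset_left with hr₁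
  set r₂ := r.restrict (r.domain \ {p : Fin 1 → ℝ | p 0 < (c : ℝ)})
    (r.isSemialgebraic_domain.diff hA₁) sdiff_subset with hr₂
  have h₁ : of r - of r₁ - of r₂ ∈ relationsLE 1 := Budget.split_mem_relationsLE le_rfl r _ hA₁
  set r₂₁ := r₂.restrict (r₂.domain ∩ {p : Fin 1 → ℝ | (c : ℝ) < p 0})
    (r₂.isSemialgebraic_domain.inter hA₂) inter_subset_left with hr₂₁
  set r₂₂ := r₂.restrict (r₂.domain \ {p : Fin 1 → ℝ | (c : ℝ) < p 0})
    (r₂.isSemialgebraic_domain.diff hA₂) sdiff_subset with hr₂₂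
  have h₂ : of r₂ - of r₂₁ - of r₂₂ ∈ relationsLE 1 :=
    Budget.split_mem_relationsLE le_rfl r₂ _ hA₂
  -- the point `{c}` is a truncated relation
  have h₃ : of r₂₂ ∈ relationsLE 1 := by
    refine Budget.of_mem_relationsLE_of_subset_point le_rfl r₂₂ c fun p hp => ?_
    obtain ⟨⟨-, hp₁⟩, hp₂⟩ := hp
    exact le_antisymm (not_lt.mp hp₂) (not_lt.mp hp₁)
  -- the two sides are one-sided pieces
  have hd₁ : r₁.domain = {p | p 0 ∈ S ∩ Iio (c : ℝ)} := by
    ext p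
    simp only [hr₁, IntegralRep.domain_restrict, mem_inter_iff, mem_setOf_eq, hmem, mem_Iio]
  have hd₂ : r₂₁.domain = {p | p 0 ∈ S ∩ Ioi (c : ℝ)} := by
    ext p
    simp only [hr₂₁, hr₂, IntegralRep.domain_restrict, mem_inter_iff, Set.mem_sdiff, mem_setOf_eq,
      hmem, mem_Ioi, not_lt]
    exact ⟨fun h => ⟨h.1.1, h.2⟩, fun h => ⟨⟨h.1, h.2.le⟩, h.2⟩⟩
  obtain ⟨x₁, hx₁, e₁⟩ := piece r₁ (S ∩ Iio (c : ℝ)) (hS.inter isOpen_Iio)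
    (hSo.inter ordConnected_Iio) inter_subset_left (fun h => lt_irrefl (c : ℝ) (mem_Iio.mp h.2)) hd₁ rfl
  obtain ⟨x₂, hx₂, e₂⟩ := piece r₂₁ (S ∩ Ioi (c : ℝ)) (hS.inter isOpen_Ioi)
    (hSo.inter ordConnected_Ioi) inter_subset_left (fun h => lt_irrefl (c : ℝ) (mem_Ioi.mp h.2)) hd₂ rfl
  refine ⟨x₁ + x₂, AddSubgroup.add_mem _ (AddSubgroup.subset_closure (Or.inl hx₁))
    (AddSubgroup.subset_closure (Or.inl hx₂)), ?_⟩
  have e : of r - (x₁ + x₂) =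
      (of r - of r₁ - of r₂) + (of r₂ - of r₂₁ - of r₂₂) + of r₂₂ + (of r₁ - x₁) + (of r₂₁ - x₂) := by
    abel
  rw [e]
  exact (relationsLE 1).add_mem ((relationsLE 1).add_mem ((relationsLE 1).add_mem
    ((relationsLE 1).add_mem h₁ h₂) h₃) e₁) e₂

end Transport

/-- **Brick `transport_arcs` (Möbius transport between models inside dimension one)** of the line
`Lines/birth.lean` of crux stmt-KontsevichZagierPeriods-12475: if `q′(u) = u^{2m} q(c + 1/u)` for
`u ≠ 0`, every element of the subgroup generated by the arc generators `[S, (A + B√q)/D]` of the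
sector of `q` and the constants is congruent modulo `KZ.relationsLE 1` to an element of the
subgroup generated by the arc generators of the sector of `q′` and the constants: each arc is cut
at `c` (rule (1a)) and each side is carried by the substitution `u = 1/(x − c)` (ONE rule-(2) move,
`Transport.moebius_oneSided`) to an arc of `q′`, and
`closure (arcs q ∪ consts) ≤ closure (arcs q′ ∪ consts) ⊔ relationsLE 1` follows generator by
generator. [cite: KontsevichZagier2001, §1.2 rules (1)–(2)] -/
theorem transport_arcs : ∀ (q q' : Polynomial ℚ) (c : ℚ) (m : ℕ), (∀ u : ℝ, u ≠ 0 → Polynomial.aeval u q' = u ^ (2 * m) * Polynomial.aeval ((c : ℝ) + u⁻¹) q) → ∀ x ∈ AddSubgroup.closure (arcs q ∪ consts), ∃ x' ∈ AddSubgroup.closure (arcs q' ∪ consts), x - x' ∈ KZ.relationsLE 1 := by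
  intro q q' c m hqq x hx
  have hle : AddSubgroup.closure (arcs q ∪ consts) ≤
      AddSubgroup.closure (arcs q' ∪ consts) ⊔ KZ.relationsLE 1 := by
    rw [AddSubgroup.closure_le]
    rintro y (hy | hy)
    · obtain ⟨x', hx', hrel⟩ := Transport.exists_of_mem_arcs hqq hy
      have e : y = x' + (y - x') := by abel
      rw [e]
      exact AddSubgroup.add_mem _ (AddSubgroup.mem_sup_left hx') (AddSubgroup.mem_sup_right hrel)
    · exact AddSubgroup.mem_sup_left (AddSubgroup.subset_closure (Or.inr hy))
  obtain ⟨g, hg, w, hw, hgw⟩ := AddSubgroup.mem_sup.mp (hle hx)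
  refine ⟨g, hg, ?_⟩
  rwa [← hgw, add_sub_cancel_left]

end Summit.KontsevichZagierPeriods.AbelContraction.RealHyperellipticSector

end
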